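/-
Copyright: lit-balaban cell (HOME `run/shared/lean/pub/lit-balaban/`), Phase-2 proof seat p12 (gen 7).  The proofs reproduce the
printed arguments; nothing is claimed beyond what the kernel checks below.
-/
import Literature.MathematicalPhysics.QuantumFieldTheory.DybalskiStottmeisterTanimoto2024.DST24CriticalPoint

/-!
# `DybalskiStottmeisterTanimoto2024.DST24CoarseBonds` — [DybalskiStottmeisterTanimoto2024] §2.1/§3.3: the factor `∂V(y_b) =
# V(y_{b₋})V(y_{b₊})*` is `1` inside a block and a coarse bond variable `∂V(c)` across a block boundary; hence
# `V ∈ 𝔘_{ε₁}(Ω₁) ⇒ ‖∂V(y_b) − 1‖ ≤ ε₁`, `|V⃗(b)| ≤ ε₁` and `δ_V = 1` for every fine bond `b`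

statement-level skeleton of published theorems with citation tags; proofs where landed; nothing here is a claim about
the Yang–Mills mass gap

W. Dybalski, A. Stottmeister, Y. Tanimoto, *The Bałaban variational problem in the non-linear sigma model*, Rev. Math. Phys.
**36** (2024), arXiv:2403.09800; source held `paper:arxiv-2403.09800` (§1.1 (box), «`y_{b_±}` was defined below (box)»; §2.1
(action-one-x′); §3.4/§4.6 hypothesis «`|V⃗(b)| ≤ ε₁`»).  Unit `lit-balaban-p12` (gen 7).

WHAT IS PRINTED AND PROVED HERE.  The standing identification of `∂V(y_b)` with a bond variable of `V ∈ Conf(Ω₁)`: for a fine bond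
`b = (x, x + e_μ)`, either `y_{b₊} = y_{b₋}` (`∂V(y_b) = 1`) or `y_{b₊} = y_{b₋} + e_μ` and `∂V(y_b) = ∂V(c)` for the coarse bond
`c = (y_{b₋}, y_{b₋} + e_μ)` — `blk_tgt_of_ne`, `coarseBond`, `pdV_eq_one_or_pdC`; consequently the hypotheses «`|V⃗(b)| ≤ ε₁`»,
`δ_V = 1` of §3.4/§4.6 (Lemmas (r-lemma-one), (r-lemma-two)) follow from `V ∈ 𝔘_{ε₁}(Ω₁)` of Theorem 1 — `norm_pdV_sub_one_le`,
`norm_vecOf_pdV_le`, `re_pdV_nonneg`. [cite: DybalskiStottmeisterTanimoto2024, §1.1 (box), (small-field-condition); §2.1 (action-one-x′)]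
-/

namespace Literature.MathematicalPhysics.QuantumFieldTheory.DybalskiStottmeisterTanimoto2024.DST24CoarseBonds

open scoped Quaternion RealInnerProductSpace BigOperators
open Literature.MathematicalPhysics.QuantumFieldTheory.Federbush1986
open Literature.MathematicalPhysics.QuantumFieldTheory.DybalskiStottmeisterTanimoto2024.DST24Setting
open Literature.MathematicalPhysics.QuantumFieldTheory.DybalskiStottmeisterTanimoto2024.DST24Configurations
open Literature.MathematicalPhysics.QuantumFieldTheory.DybalskiStottmeisterTanimoto2024.DST24CriticalPoint

noncomputable section

variable {L n₁ : ℕ}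

/-- The block label is unchanged in the directions orthogonal to the bond. [cite: DybalskiStottmeisterTanimoto2024, §1.1 (box)] -/
theorem blk_tgt_of_ne (b : Bond L n₁) {ν : Fin 2} (hν : ν ≠ b.dir) : blk b.tgt ν = blk b.src ν := by
  apply Fin.ext
  rw [blk_apply, blk_apply, b.tgt_apply_of_ne hν]

/-- In the bond direction the block label moves by `0` or `1`: `y_{b₊,μ} = y_{b₋,μ}` or `= y_{b₋,μ} + 1`.
[cite: DybalskiStottmeisterTanimoto2024, §1.1 (box)] -/
theorem blk_tgt_dir (b : Bond L n₁) :
    ((blk b.tgt b.dir : Fin n₁) : ℕ) = (blk b.src b.dir : ℕ) ∨ ((blk b.tgt b.dir : Fin n₁) : ℕ) = (blk b.src b.dir : ℕ) + 1 := by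
  rw [blk_apply, blk_apply, b.tgt_apply_dir]
  by_cases h : L ∣ (b.src b.dir : ℕ) + 1
  · right; rw [Nat.succ_div_of_dvd h]
  · left; rw [Nat.succ_div_of_not_dvd h]

/-- The coarse bond `c = (y, y + e_μ)` under a fine bond crossing a block boundary in direction `μ`.
[cite: DybalskiStottmeisterTanimoto2024, §1.1 («`Ω′₁` the set of oriented bonds on `Ω₁`»)] -/
def coarseBond (b : Bond L n₁) (h : ((blk b.tgt b.dir : Fin n₁) : ℕ) = (blk b.src b.dir : ℕ) + 1) : CBond n₁ :=
  ⟨(blk b.src, b.dir), by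
    show ((blk b.src b.dir : Fin n₁) : ℕ) + 1 < n₁
    have := (blk b.tgt b.dir).isLt
    omega⟩

/-- The coarse bond starts at `y_{b₋}`. [cite: DybalskiStottmeisterTanimoto2024, §1.1 (box)] -/
theorem coarseBond_src (b : Bond L n₁) (h : ((blk b.tgt b.dir : Fin n₁) : ℕ) = (blk b.src b.dir : ℕ) + 1) :
    (coarseBond b h).src = blk b.src := rfl

/-- The coarse bond ends at `y_{b₊}`. [cite: DybalskiStottmeisterTanimoto2024, §1.1 (box)] -/
theorem coarseBond_tgt (b : Bond L n₁) (h : ((blk b.tgt b.dir : Fin n₁) : ℕ) = (blk b.src b.dir : ℕ) + 1) :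
    (coarseBond b h).tgt = blk b.tgt := by
  funext ν
  simp only [CBond.tgt, coarseBond]
  by_cases hν : ν = b.dir
  · subst hν
    rw [Function.update_self]
    exact Fin.ext h.symm
  · rw [Function.update_of_ne hν, blk_tgt_of_ne b hν]

/-- `∂V(y_b) = 1` inside a block, `= ∂V(c)` (a coarse bond variable) across a block boundary.
[cite: DybalskiStottmeisterTanimoto2024, §2.1 (action-one-x′) («`∂V(y_b) := V(y_{b₋})V(y_{b₊})*`»)] -/
theorem pdV_eq_one_or_pdC (V : CConf n₁) (b : Bond L n₁) :
    pdV V b = 1 ∨ ∃ c : CBond n₁, pdV V b = (pdC V c).val := by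
  rcases blk_tgt_dir b with h | h
  · left
    have hb : blk b.tgt = blk b.src := by
      funext ν
      by_cases hν : ν = b.dir
      · subst hν; exact Fin.ext h
      · exact blk_tgt_of_ne b hν
    rw [pdV, hb, SU2.val_mul_star_val]
  · right
    refine ⟨coarseBond b h, ?_⟩
    rw [pdV, pdC_val, coarseBond_tgt b h, coarseBond_src]

/-- `V ∈ 𝔘_{ε₁}(Ω₁) ⇒ ‖∂V(y_b) − 1‖ ≤ ε₁` for every fine bond. [cite: DybalskiStottmeisterTanimoto2024, §1.1 (small-field-condition) on `Ω₁`; §3.4 («for `ε, ε₁` sufficiently small»)] -/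
theorem norm_pdV_sub_one_le {ε₁ : ℝ} (hε₁ : 0 ≤ ε₁) {V : CConf n₁} (hV : V ∈ smallFieldC ε₁) (b : Bond L n₁) :
    ‖pdV V b - 1‖ ≤ ε₁ := by
  rcases pdV_eq_one_or_pdC V b with h | ⟨c, h⟩
  · rw [h, sub_self, norm_zero]; exact hε₁
  · rw [h]; exact hV c

/-- «`|V⃗(b)| ≤ ε₁`» (hypothesis of Lemmas (r-lemma-one), (r-lemma-two)) from `V ∈ 𝔘_{ε₁}(Ω₁)`, `ε₁ ≤ 1`.
[cite: DybalskiStottmeisterTanimoto2024, §4.6 Lemma (r-lemma-one) (hypothesis); §2.2 Lemma (A-theorem)] -/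
theorem norm_vecOf_pdV_le {ε₁ : ℝ} (hε₁ : 0 ≤ ε₁) (hε₁' : ε₁ ≤ 1) {V : CConf n₁} (hV : V ∈ smallFieldC ε₁)
    (b : Bond L n₁) : ‖vecOf (pdV V b)‖ ≤ ε₁ := by
  have h := norm_pdV_sub_one_le hε₁ hV b
  have := A_theorem_site hε₁' (V (blk b.src) * (V (blk b.tgt))⁻¹) h
  exact this.1

/-- `δ_V = 1`: `Re ∂V(y_b) ≥ 0` from `V ∈ 𝔘_{ε₁}(Ω₁)`, `ε₁ ≤ 1` («the corresponding signs `δ` equal `1`», §3.4).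
[cite: DybalskiStottmeisterTanimoto2024, §3.4 («we can lower all the `0`-superscripts»); §2.2 Lemma (A-theorem)] -/
theorem re_pdV_nonneg {ε₁ : ℝ} (hε₁ : 0 ≤ ε₁) (hε₁' : ε₁ ≤ 1) {V : CConf n₁} (hV : V ∈ smallFieldC ε₁)
    (b : Bond L n₁) : 0 ≤ (pdV V b).re := by
  have h := norm_pdV_sub_one_le hε₁ hV b
  have := (A_theorem_site hε₁' (V (blk b.src) * (V (blk b.tgt))⁻¹) h).2
  unfold sgn at this
  exact le_of_lt (sign_eq_one_iff.mp this)

end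

end Literature.MathematicalPhysics.QuantumFieldTheory.DybalskiStottmeisterTanimoto2024.DST24CoarseBonds
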